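import Literature.AnabelianGeometry.EtaleTheta.TemperedFrobenioidCor38SubPreStepsFrobeniusFactor
import Literature.AnabelianGeometry.EtaleTheta.TemperedFrobenioidCor38SubPreStepsMonoDescent
import Literature.AnabelianGeometry.EtaleTheta.TemperedFrobenioidCor38SubPreStepsUnitObstruction
import HarnessLib

/-!
# [EtTh] Cor. 3.8 proof row C38-L02a `PreservesPreSteps` (F-2809): the POWER OBSTRUCTION — degree half for every
# pre-step without monicity of the base, and two structural closers of the row

S. Mochizuki, *The étale theta function and its Frobenioid-theoretic manifestations*, Publ. RIMS **45** (2009)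
[EtTh], Cor. 3.8, proof, PDF p. 81 l. 2–3 ("by [Mzk17], Theorem 3.4, (ii) … it follows that `Ψ` preserves
pre-steps") [cite: MochizukiEtTh2009, Cor 3.8 p.81]; S. Mochizuki, *The geometry of Frobenioids I*, Kyushu J. Math.
**62** (2008) [FrdI], §0 p. 14 (fiberwise-surjective and FSM-morphisms, categories of FSM-type), Def. 1.2 (iii)
p. 22 (pre-steps), Thm. 5.2 (i) p. 100 (model Frobenioids) [cite: MochizukiFrdI2008, Thm. 5.2(i) p.100].

abc-iut cell, block C / W6, seat abc-iut-w6-d040 (gen 4).  PROOF-ONLY file (0 definitions), the `Cor38Hyp` half of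
the Frobenius-factorisation hand (`TemperedFrobenioidCor38SubPreStepsFrobeniusFactor.lean`, same seat) for the decision
on the bare universal closure of `Cor38Hyp.PreservesPreSteps` (FACT-LIST F-2809, lease abc-iut-f-032).  For EVERY
record `h : Cor38Hyp C₁ C₂`:
* `Cor38Hyp.isFiberwiseSurjective_powUnitHom_of_isPreStep` (+ `Ψ⁻¹` mirror): for every pre-step `φ` of `C₁` the
  PURE Frobenius morphism `F_d` out of `Ψ X`, `d := deg_Fr(Ψ φ)`, is fiberwise-surjective in `C₂`;
* `Cor38Hyp.isLinear_map_of_isPreStep_of_powerObstruction` (+ mirror): if at every object of `D₂` and for every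
  `d ≥ 2` some `u ∈ B(A)` with `z₀^d·Div_B(u)` effective has no `d`-th-power pull-back, `Ψ φ` is LINEAR for every
  pre-step `φ` — no monicity of `Base(Ψ φ)`, no partner, no F-2815; abc-iut-f-111's genuine-unit hypothesis is the
  case `z₀ = Z = 0` (`Cor38Hyp.isLinear_map_of_isPreStep_of_unitObstruction'`, abc-iut-f-111's statement WITHOUT its
  `Mono (Base (Ψ φ))` instance), and a pull-back-invariant valuation `χ : B → ℤ` with `χ(u) = 1` supplies the
  obstruction (`Cor38Hyp.isLinear_map_of_isPreStep_of_valuation`, abc-iut-f-111's `unitObstruction_of_valuation`);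
* closers: `Cor38Hyp.preservesPreSteps_of_powerObstruction_of_isIso_of_isFiberwiseSurjective` (power obstruction +
  "fiberwise-surjective ⇒ invertible" in `D₁`, `D₂`) and `Cor38Hyp.preservesPreSteps_of_powerObstruction_of_isOfFSMType`
  (power obstruction + CANCELLATIVE `Φ` + `D₁`, `D₂` of FSM-type: a linear image has FSM base by abc-iut-w6-d057 /
  abc-iut-w6-d079, hence invertible base).
READING (cell rule R5; FACT-LIST label of F-2809 NOT moved: conditional / instance PROVED / bare closure open): with
this hand a separating record must move a partner-less pre-step EITHER to a linear morphism over a non-invertible FSM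
arrow between two distinct objects of `D₂`, OR to a linear morphism over a non-monic fiberwise-surjective arrow, OR to
a morphism of degree `d ≥ 2` out of an object `A` at which EVERY `u ∈ B(A)` with `z₀^d·Div_B(u)` effective has a
`d`-th-power pull-back (no valuation on `B(A)` at all: `B` trivial, divisible or torsion there).  No [FrdI] Thm. 3.4
input; no Frobenioid axiom; vocabulary clauses untouched.
HONEST FRAMING: bookkeeping about OUR typed Def. 3.6 interface (print's Cor. 3.8 quotes [FrdI] Thm. 3.4 (ii) for
genuine Frobenioids); nothing here bears on [IUTchIII] Cor. 3.12; no side taken; a FACT row is an assumption label;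
typed ≠ proved.
-/

namespace Literature.AnabelianGeometry.EtaleTheta

open CategoryTheory Opposite Literature.AlgebraicGeometry.Frobenioids

universe u₀ v₀ u v w

variable {D₀ : Type u₀} [Category.{v₀} D₀] {V : FrdIMonoidStub.{w}}
  {T : RealifiedDivisorMonoids (D₀ := D₀) V} {D : Type u} [Category.{v} D] {VD : FrdICatStub.{u, v, w} D}
  {D₀' : Type u₀} [Category.{v₀} D₀'] {T' : RealifiedDivisorMonoids (D₀ := D₀') V}
  {D' : Type u} [Category.{v} D'] {VD' : FrdICatStub.{u, v, w} D'}
  {C₁ : TemperedFrobenioid T D VD} {C₂ : TemperedFrobenioid T' D' VD'}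

namespace Cor38Hyp

variable (h : Cor38Hyp C₁ C₂)

/-- For every record `h` and every pre-step `φ` of `C₁`: the pure Frobenius morphism `F_d` out of `Ψ X`,
`d := deg_Fr(Ψ φ)`, is fiberwise-surjective in `C₂`. [cite: MochizukiEtTh2009, Cor 3.8 p.81] -/
theorem isFiberwiseSurjective_powUnitHom_of_isPreStep {X Y : C₁.category} (φ : X ⟶ Y)
    (hφ : C₁.opsData.IsPreStep φ) :
    IsFiberwiseSurjective (ModelFrobenioid.powUnitHom C₂.divisorMonoid C₂.ratFnFunctor C₂.divBNatTrans
      (ModelFrobenioid.degFr (h.Ψ.functor.map φ)) (h.Ψ.functor.obj X)) :=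
  TemperedFrobenioid.isFiberwiseSurjective_powUnitHom_of_isPreStep h.Ψ φ hφ

/-- The mirror for `Ψ⁻¹`. [cite: MochizukiEtTh2009, Cor 3.8 p.81] -/
theorem isFiberwiseSurjective_powUnitHom_of_isPreStep_inverse {X Y : C₂.category} (φ : X ⟶ Y)
    (hφ : C₂.opsData.IsPreStep φ) :
    IsFiberwiseSurjective (ModelFrobenioid.powUnitHom C₁.divisorMonoid C₁.ratFnFunctor C₁.divBNatTrans
      (ModelFrobenioid.degFr (h.Ψ.inverse.map φ)) (h.Ψ.inverse.obj X)) :=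
  TemperedFrobenioid.isFiberwiseSurjective_powUnitHom_of_isPreStep h.Ψ.symm φ hφ

/-- **Row C38-L02a / F-2809, DEGREE HALF from a power obstruction, for EVERY record**: if at every object of
`D₂` and for every `d ≥ 2` the rational-function monoid `B` of `C₂` has an element `u` with `z₀^d·Div_B(u)`
effective and no `d`-th-power pull-back, then `Ψ φ` is linear for EVERY pre-step `φ` of `C₁` (no monicity of
`Base(Ψ φ)`, no partner, no F-2815). [cite: MochizukiEtTh2009, Cor 3.8 p.81] -/
theorem isLinear_map_of_isPreStep_of_powerObstruction
    (hK : ∀ (A : D') (d : ℕ+), d ≠ 1 → ∃ (u : (C₂.ratFnFunctor.obj (op A) : Type w))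
      (z₀ z : (C₂.divisorMonoid.obj (op A) : Type w)),
      Algebra.GrothendieckGroup.of z = Algebra.GrothendieckGroup.of z₀ ^ (d : ℕ) *
        divB C₂.divisorMonoid C₂.ratFnFunctor C₂.divBNatTrans (op A) u ∧
      ∀ ⦃E : D'⦄ (g : E ⟶ A) (t : (C₂.ratFnFunctor.obj (op E) : Type w)),
        (C₂.ratFnFunctor.map g.op).hom u ≠ t ^ (d : ℕ))
    {X Y : C₁.category} (φ : X ⟶ Y) (hφ : C₁.opsData.IsPreStep φ) :
    C₂.opsData.IsLinear (h.Ψ.functor.map φ) :=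
  TemperedFrobenioid.isLinear_map_of_isPreStep_of_powerObstruction h.Ψ hK φ hφ

/-- The mirror for `Ψ⁻¹`: power obstruction in `C₁` ⇒ `Ψ⁻¹ φ` linear for every pre-step `φ` of `C₂`.
[cite: MochizukiEtTh2009, Cor 3.8 p.81] -/
theorem isLinear_inverse_map_of_isPreStep_of_powerObstruction
    (hK : ∀ (A : D) (d : ℕ+), d ≠ 1 → ∃ (u : (C₁.ratFnFunctor.obj (op A) : Type w))
      (z₀ z : (C₁.divisorMonoid.obj (op A) : Type w)),
      Algebra.GrothendieckGroup.of z = Algebra.GrothendieckGroup.of z₀ ^ (d : ℕ) *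
        divB C₁.divisorMonoid C₁.ratFnFunctor C₁.divBNatTrans (op A) u ∧
      ∀ ⦃E : D⦄ (g : E ⟶ A) (t : (C₁.ratFnFunctor.obj (op E) : Type w)),
        (C₁.ratFnFunctor.map g.op).hom u ≠ t ^ (d : ℕ))
    {X Y : C₂.category} (φ : X ⟶ Y) (hφ : C₂.opsData.IsPreStep φ) :
    C₁.opsData.IsLinear (h.Ψ.inverse.map φ) :=
  TemperedFrobenioid.isLinear_map_of_isPreStep_of_powerObstruction h.Ψ.symm hK φ hφ

/-- **abc-iut-f-111's degree half WITHOUT the monicity of `Base(Ψ φ)`**: if at every object of `D₂` and for every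
`d ≥ 2` the monoid `B` of `C₂` has a GENUINE unit (`Div_B v = 0`) with no `d`-th-power pull-back, then `Ψ φ` is
linear for every pre-step `φ` of `C₁`. [cite: MochizukiEtTh2009, Cor 3.8 p.81] -/
theorem isLinear_map_of_isPreStep_of_unitObstruction'
    (hK : ∀ (A : D') (d : ℕ+), d ≠ 1 → ∃ v : (C₂.ratFnFunctor.obj (op A) : Type w),
      divB C₂.divisorMonoid C₂.ratFnFunctor C₂.divBNatTrans (op A) v = 1 ∧
      ∀ ⦃E : D'⦄ (g : E ⟶ A) (t : (C₂.ratFnFunctor.obj (op E) : Type w)),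
        (C₂.ratFnFunctor.map g.op).hom v ≠ t ^ (d : ℕ))
    {X Y : C₁.category} (φ : X ⟶ Y) (hφ : C₁.opsData.IsPreStep φ) :
    C₂.opsData.IsLinear (h.Ψ.functor.map φ) := by
  refine h.isLinear_map_of_isPreStep_of_powerObstruction (fun A d hd => ?_) φ hφ
  obtain ⟨v, hv, hnot⟩ := hK A d hd
  exact ⟨v, 1, 1, by rw [hv, map_one, one_pow, mul_one], hnot⟩

/-- The mirror for `Ψ⁻¹`. [cite: MochizukiEtTh2009, Cor 3.8 p.81] -/
theorem isLinear_inverse_map_of_isPreStep_of_unitObstruction'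
    (hK : ∀ (A : D) (d : ℕ+), d ≠ 1 → ∃ v : (C₁.ratFnFunctor.obj (op A) : Type w),
      divB C₁.divisorMonoid C₁.ratFnFunctor C₁.divBNatTrans (op A) v = 1 ∧
      ∀ ⦃E : D⦄ (g : E ⟶ A) (t : (C₁.ratFnFunctor.obj (op E) : Type w)),
        (C₁.ratFnFunctor.map g.op).hom v ≠ t ^ (d : ℕ))
    {X Y : C₂.category} (φ : X ⟶ Y) (hφ : C₂.opsData.IsPreStep φ) :
    C₁.opsData.IsLinear (h.Ψ.inverse.map φ) := by
  refine h.isLinear_inverse_map_of_isPreStep_of_powerObstruction (fun A d hd => ?_) φ hφ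
  obtain ⟨v, hv, hnot⟩ := hK A d hd
  exact ⟨v, 1, 1, by rw [hv, map_one, one_pow, mul_one], hnot⟩

/-- **Structural closer of row C38-L02a (F-2809)**: power obstruction in `C₁`, `C₂` and "fiberwise-surjective ⇒
invertible" in `D₁`, `D₂` ⇒ `Ψ` preserves pre-steps (abc-iut-f-111's closer with the genuine unit replaced by any
non-`d`-divisible effective principal divisor). [cite: MochizukiEtTh2009, Cor 3.8 p.81] -/
theorem preservesPreSteps_of_powerObstruction_of_isIso_of_isFiberwiseSurjective
    (hD : ∀ ⦃a b : D⦄ (g : a ⟶ b), IsFiberwiseSurjective g → IsIso g)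
    (hD' : ∀ ⦃a b : D'⦄ (g : a ⟶ b), IsFiberwiseSurjective g → IsIso g)
    (hK₁ : ∀ (A : D) (d : ℕ+), d ≠ 1 → ∃ (u : (C₁.ratFnFunctor.obj (op A) : Type w))
      (z₀ z : (C₁.divisorMonoid.obj (op A) : Type w)),
      Algebra.GrothendieckGroup.of z = Algebra.GrothendieckGroup.of z₀ ^ (d : ℕ) *
        divB C₁.divisorMonoid C₁.ratFnFunctor C₁.divBNatTrans (op A) u ∧
      ∀ ⦃E : D⦄ (g : E ⟶ A) (t : (C₁.ratFnFunctor.obj (op E) : Type w)),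
        (C₁.ratFnFunctor.map g.op).hom u ≠ t ^ (d : ℕ))
    (hK₂ : ∀ (A : D') (d : ℕ+), d ≠ 1 → ∃ (u : (C₂.ratFnFunctor.obj (op A) : Type w))
      (z₀ z : (C₂.divisorMonoid.obj (op A) : Type w)),
      Algebra.GrothendieckGroup.of z = Algebra.GrothendieckGroup.of z₀ ^ (d : ℕ) *
        divB C₂.divisorMonoid C₂.ratFnFunctor C₂.divBNatTrans (op A) u ∧
      ∀ ⦃E : D'⦄ (g : E ⟶ A) (t : (C₂.ratFnFunctor.obj (op E) : Type w)),
        (C₂.ratFnFunctor.map g.op).hom u ≠ t ^ (d : ℕ)) :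
    h.PreservesPreSteps :=
  ⟨fun _ _ φ hφ => ⟨h.isLinear_map_of_isPreStep_of_powerObstruction hK₂ φ hφ,
      hD' _ (h.isFiberwiseSurjective_baseMap_map_of_isPreStep φ hφ)⟩,
    fun _ _ φ hφ => ⟨h.isLinear_inverse_map_of_isPreStep_of_powerObstruction hK₁ φ hφ,
      hD _ (h.isFiberwiseSurjective_baseMap_inverse_map_of_isPreStep φ hφ)⟩⟩

/-- **Structural closer of row C38-L02a (F-2809) over bases of FSM-type**: power obstruction and CANCELLATIVE divisor
monoids in `C₁`, `C₂`, and `D₁`, `D₂` of FSM-type ([FrdI] §0 p. 14: every FSM arrow invertible — e.g. one-object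
bases of FSMFF-type all of whose arrows are monic, groupoids, points) ⇒ `Ψ` preserves pre-steps: the image of a
pre-step is linear (this file), so its base is monic (abc-iut-w6-d079, degree-one mono descent) and fiberwise-surjective
(abc-iut-w6-d057), i.e. FSM, hence invertible. [cite: MochizukiEtTh2009, Cor 3.8 p.81] -/
theorem preservesPreSteps_of_powerObstruction_of_isOfFSMType (hD : IsOfFSMType D) (hD' : IsOfFSMType D')
    (hΦ₁ : ∀ (A : Dᵒᵖ) (x y z : C₁.Φ.carrier A), x * y = x * z → y = z)
    (hΦ₂ : ∀ (A : D'ᵒᵖ) (x y z : C₂.Φ.carrier A), x * y = x * z → y = z)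
    (hK₁ : ∀ (A : D) (d : ℕ+), d ≠ 1 → ∃ (u : (C₁.ratFnFunctor.obj (op A) : Type w))
      (z₀ z : (C₁.divisorMonoid.obj (op A) : Type w)),
      Algebra.GrothendieckGroup.of z = Algebra.GrothendieckGroup.of z₀ ^ (d : ℕ) *
        divB C₁.divisorMonoid C₁.ratFnFunctor C₁.divBNatTrans (op A) u ∧
      ∀ ⦃E : D⦄ (g : E ⟶ A) (t : (C₁.ratFnFunctor.obj (op E) : Type w)),
        (C₁.ratFnFunctor.map g.op).hom u ≠ t ^ (d : ℕ))
    (hK₂ : ∀ (A : D') (d : ℕ+), d ≠ 1 → ∃ (u : (C₂.ratFnFunctor.obj (op A) : Type w))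
      (z₀ z : (C₂.divisorMonoid.obj (op A) : Type w)),
      Algebra.GrothendieckGroup.of z = Algebra.GrothendieckGroup.of z₀ ^ (d : ℕ) *
        divB C₂.divisorMonoid C₂.ratFnFunctor C₂.divBNatTrans (op A) u ∧
      ∀ ⦃E : D'⦄ (g : E ⟶ A) (t : (C₂.ratFnFunctor.obj (op E) : Type w)),
        (C₂.ratFnFunctor.map g.op).hom u ≠ t ^ (d : ℕ)) :
    h.PreservesPreSteps := by
  refine ⟨fun X Y φ hφ => ?_, fun X Y φ hφ => ?_⟩
  · have hlin := h.isLinear_map_of_isPreStep_of_powerObstruction hK₂ φ hφ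
    exact ⟨hlin, hD'.isIso_of_isFSM _ (h.isFSM_baseMap_map_of_isPreStep_of_isLinear hΦ₁ φ hφ hlin)⟩
  · have hlin := h.isLinear_inverse_map_of_isPreStep_of_powerObstruction hK₁ φ hφ
    have hφ' := (C₂.opsData_isPreStep_iff φ).1 hφ
    haveI : IsIso (ModelFrobenioid.baseMap φ) := hφ'.2
    haveI : Mono φ := C₂.mono_of_degFr_eq_one hΦ₂ φ hφ'.1
    haveI : Mono (h.Ψ.inverse.map φ) := h.mono_inverse_map_of_mono φ
    exact ⟨hlin, hD.isIso_of_isFSM _ ⟨h.isFiberwiseSurjective_baseMap_inverse_map_of_isPreStep φ hφ,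
      ModelFrobenioid.mono_baseMap_of_mono_of_degFr_eq_one _ hlin⟩⟩

/-- **The power obstruction from a valuation** (re-using abc-iut-f-111's `ModelFrobenioid.unitObstruction_of_valuation`,
whose conclusion does not involve `Div_B`): a pull-back-invariant homomorphism `χ : B → ℤ` of `C₂` and, at every object and
for every `d ≥ 2`, some `u` with `χ(u) = 1` and `z₀^d·Div_B(u)` effective ⇒ `Ψ φ` linear for every pre-step `φ` of `C₁`.
[cite: MochizukiEtTh2009, Cor 3.8 p.81] -/
theorem isLinear_map_of_isPreStep_of_valuation
    (χ : ∀ A : D'ᵒᵖ, (C₂.ratFnFunctor.obj A : Type w) →* Multiplicative ℤ)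
    (hχ : ∀ ⦃A A' : D'ᵒᵖ⦄ (f : A ⟶ A') (b : (C₂.ratFnFunctor.obj A : Type w)),
      χ A' ((C₂.ratFnFunctor.map f).hom b) = χ A b)
    (hu : ∀ (A : D') (d : ℕ+), d ≠ 1 → ∃ (u : (C₂.ratFnFunctor.obj (op A) : Type w))
      (z₀ z : (C₂.divisorMonoid.obj (op A) : Type w)),
      Algebra.GrothendieckGroup.of z = Algebra.GrothendieckGroup.of z₀ ^ (d : ℕ) *
        divB C₂.divisorMonoid C₂.ratFnFunctor C₂.divBNatTrans (op A) u ∧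
      χ (op A) u = Multiplicative.ofAdd 1)
    {X Y : C₁.category} (φ : X ⟶ Y) (hφ : C₁.opsData.IsPreStep φ) :
    C₂.opsData.IsLinear (h.Ψ.functor.map φ) := by
  refine h.isLinear_map_of_isPreStep_of_powerObstruction (fun A d hd => ?_) φ hφ
  obtain ⟨u, z₀, z, hz, hχu⟩ := hu A d hd
  exact ⟨u, z₀, z, hz, ModelFrobenioid.unitObstruction_of_valuation χ hχ u hχu hd⟩

end Cor38Hyp

end Literature.AnabelianGeometry.EtaleTheta
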